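import Mathlib
import HarnessLib

/-!
# Stub `stub_gridData` — crux `TorsionLogs.NeronTorsionSector`, line `registered` (block U6), I:
# dictionary-free tools

Auxiliary file for `TorsionLogsNeronTorsionSectorStubGridData.lean` (the real Weierstrass
dictionary specialised to the torsion grid). This file contains the tools that do not mention
the dictionary:

* `gridData_isAlgebraic_of_quartic` — a real root of a monic quartic with algebraic coefficients is
  algebraic over `ℚ` (integrality over `integralClosure ℚ ℝ` + `isIntegral_trans`); used for the
  halving of algebraic points through the duplication formula of `℘`;
* `gridData_torsion_arith` — reduction of `a/N` to lowest terms `a′/N′` with `2a′ < N′`;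
* `gridData_cubic_lt` — the cubic `f = 4x³ − g₂x − g₃` is strictly increasing on `[e₁, ∞)`
  when `e₁ > 0` is a root beyond which `f > 0`;
* `gridData_strictMonoOn_conj`, `gridData_strictAntiOn_conj`, `gridData_image_conj` and the
  `gridData_image_I??` lemmas — transport of monotonicity and of interval images through a
  strictly decreasing parametrisation `X : (0, H] → [e, ∞)` (here: `X = ℘|ℝ` on the half
  period), for maps of the form `φ ∘ X = X ∘ g`.

References: D. F. Lawden, *Elliptic Functions and Applications* (1989), §6.7–6.8;
J. H. Silverman, *The Arithmetic of Elliptic Curves* (2009), III.2.3.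
-/

noncomputable section

-- `Summit.KontsevichZagierPeriods.KontsevichZagierPeriods.…` is the tree's mandated layout (single-conjunct summit).
set_option linter.dupNamespace false

open Set Polynomial

namespace Summit.KontsevichZagierPeriods.KontsevichZagierPeriods.Cruxes.NeronTorsionSector.Translation

/-! ### Algebraicity through a quartic -/

/-- A real root `x` of a monic quartic `x⁴ + a₃x³ + a₂x² + a₁x + a₀ = 0` whose coefficients are
algebraic over `ℚ` is algebraic over `ℚ`: `x` is integral over the integral closure of `ℚ` in `ℝ`,
hence integral over `ℚ` (`isIntegral_trans`). [folklore] -/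
theorem gridData_isAlgebraic_of_quartic : ∀ {x a₃ a₂ a₁ a₀ : ℝ}, IsAlgebraic ℚ a₃ →
    IsAlgebraic ℚ a₂ → IsAlgebraic ℚ a₁ → IsAlgebraic ℚ a₀ →
    x ^ 4 + a₃ * x ^ 3 + a₂ * x ^ 2 + a₁ * x + a₀ = 0 → IsAlgebraic ℚ x := by
  intro x a₃ a₂ a₁ a₀ h₃ h₂ h₁ h₀ hx
  have hint : IsIntegral (integralClosure ℚ ℝ) x := by
    refine ⟨X ^ 4 + C (⟨a₃, h₃.isIntegral⟩ : integralClosure ℚ ℝ) * X ^ 3 +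
      C (⟨a₂, h₂.isIntegral⟩ : integralClosure ℚ ℝ) * X ^ 2 +
      C (⟨a₁, h₁.isIntegral⟩ : integralClosure ℚ ℝ) * X +
      C (⟨a₀, h₀.isIntegral⟩ : integralClosure ℚ ℝ), ?_, ?_⟩
    · monicity!
    · simp only [eval₂_add, eval₂_mul, eval₂_pow, eval₂_X, eval₂_C]
      simpa using hx
  exact (isIntegral_trans x hint).isAlgebraic

/-! ### Arithmetic of the torsion order -/

/-- Reduction of `a/N` (`0 < a`, `2a < N`) to lowest terms: `a = a′g`, `N = N′g` with
`g = gcd(a, N)`, `a′, N′` coprime, `1 ≤ a′` and `2a′ < N′`. [folklore] -/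
theorem gridData_torsion_arith {N a : ℕ} (ha : 0 < a) (h2a : 2 * a < N) :
    ∃ g a' N' : ℕ, 0 < g ∧ a = a' * g ∧ N = N' * g ∧ Nat.Coprime a' N' ∧ 1 ≤ a' ∧ 2 * a' < N' := by
  have hg : 0 < Nat.gcd a N := Nat.gcd_pos_of_pos_left N ha
  have h1 : a / Nat.gcd a N * Nat.gcd a N = a := Nat.div_mul_cancel (Nat.gcd_dvd_left a N)
  have h2 : N / Nat.gcd a N * Nat.gcd a N = N := Nat.div_mul_cancel (Nat.gcd_dvd_right a N)
  refine ⟨Nat.gcd a N, a / Nat.gcd a N, N / Nat.gcd a N, hg, h1.symm, h2.symm,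
    Nat.coprime_div_gcd_div_gcd hg, ?_, ?_⟩
  · exact Nat.div_pos (Nat.le_of_dvd ha (Nat.gcd_dvd_left _ _)) hg
  · refine Nat.lt_of_mul_lt_mul_right (a := Nat.gcd a N) ?_
    rw [mul_assoc, h1, h2]
    exact h2a

/-! ### The cubic is increasing on the identity component -/

/-- If `e₁ > 0` is a root of `f = 4x³ − g₂x − g₃` with `f > 0` on `(e₁, ∞)`, then `f` is strictly
increasing on `[e₁, ∞)`: `f t − f s = (t − s)(4(t² + ts + s²) − g₂)` and
`4(t² + ts + s²) − g₂ ≥ 4(t² + te₁ + e₁²) − g₂ = f(t)/(t − e₁) > 0`. [folklore] -/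
theorem gridData_cubic_lt {g₂ g₃ e₁ : ℝ} {f : ℝ → ℝ} (hf : ∀ x, f x = 4 * x ^ 3 - g₂ * x - g₃)
    (he : f e₁ = 0) (he0 : 0 < e₁) (hpos : ∀ x, e₁ < x → 0 < f x) {s t : ℝ} (hs : e₁ ≤ s)
    (hst : s < t) : f s < f t := by
  have ht : e₁ < t := lt_of_le_of_lt hs hst
  have hft := hpos t ht
  rw [hf] at he hft ⊢
  rw [hf]
  have h1 : 0 < 4 * (t ^ 2 + t * e₁ + e₁ ^ 2) - g₂ := by
    have e : 4 * t ^ 3 - g₂ * t - g₃ = (t - e₁) * (4 * (t ^ 2 + t * e₁ + e₁ ^ 2) - g₂) := by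
      linear_combination he
    rw [e] at hft
    by_contra h0
    push Not at h0
    nlinarith [mul_nonneg (sub_nonneg.2 ht.le) (neg_nonneg.2 h0)]
  have h2 : 4 * (t ^ 2 + t * e₁ + e₁ ^ 2) - g₂ ≤ 4 * (t ^ 2 + t * s + s ^ 2) - g₂ := by
    nlinarith [mul_le_mul_of_nonneg_left hs (by linarith : (0 : ℝ) ≤ t)]
  have e : 4 * t ^ 3 - g₂ * t - g₃ - (4 * s ^ 3 - g₂ * s - g₃) =
      (t - s) * (4 * (t ^ 2 + t * s + s ^ 2) - g₂) := by ring
  have : 0 < (t - s) * (4 * (t ^ 2 + t * s + s ^ 2) - g₂) := mul_pos (by linarith) (by linarith)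
  linarith

/-! ### Transport of monotonicity and images through a decreasing parametrisation -/

/-- If `φ ∘ X = X ∘ g` on `P ⊆ D`, `X` is strictly decreasing on `D`, `g` maps `P` into `D` and is
strictly increasing on `P`, then `φ` is strictly increasing on `X(P)`. [folklore] -/
theorem gridData_strictMonoOn_conj {X φ g : ℝ → ℝ} {D P : Set ℝ} (hanti : StrictAntiOn X D)
    (hP : P ⊆ D) (hg : MapsTo g P D) (hgm : StrictMonoOn g P) (hφ : ∀ u ∈ P, φ (X u) = X (g u)) :
    StrictMonoOn φ (X '' P) := by
  rintro _ ⟨u, hu, rfl⟩ _ ⟨v, hv, rfl⟩ hlt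
  rw [hφ u hu, hφ v hv]
  exact hanti (hg hv) (hg hu) (hgm hv hu ((hanti.lt_iff_gt (hP hu) (hP hv)).1 hlt))

/-- If `φ ∘ X = X ∘ g` on `P ⊆ D`, `X` is strictly decreasing on `D`, `g` maps `P` into `D` and is
strictly decreasing on `P`, then `φ` is strictly decreasing on `X(P)`. [folklore] -/
theorem gridData_strictAntiOn_conj {X φ g : ℝ → ℝ} {D P : Set ℝ} (hanti : StrictAntiOn X D)
    (hP : P ⊆ D) (hg : MapsTo g P D) (hgm : StrictAntiOn g P) (hφ : ∀ u ∈ P, φ (X u) = X (g u)) :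
    StrictAntiOn φ (X '' P) := by
  rintro _ ⟨u, hu, rfl⟩ _ ⟨v, hv, rfl⟩ hlt
  rw [hφ u hu, hφ v hv]
  exact hanti (hg hu) (hg hv) (hgm hv hu ((hanti.lt_iff_gt (hP hu) (hP hv)).1 hlt))

/-- If `φ ∘ X = X ∘ g` on `P` then `φ(X(P)) = X(g(P))`. [folklore] -/
theorem gridData_image_conj {X φ g : ℝ → ℝ} {P : Set ℝ} (hφ : ∀ u ∈ P, φ (X u) = X (g u)) :
    φ '' (X '' P) = X '' (g '' P) := by
  rw [image_image, image_image]
  exact image_congr fun u hu => hφ u hu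

section Param

variable {X : ℝ → ℝ} {H e : ℝ} (hanti : StrictAntiOn X (Ioc 0 H))
  (hXe : ∀ u ∈ Ioc 0 H, e ≤ X u) (hsurj : ∀ t, e ≤ t → ∃ u ∈ Ioc 0 H, X u = t)

include hanti hXe hsurj

/-- A strictly decreasing bijection `X : (0, H] → [e, ∞)` maps `(a, b)` onto `(X b, X a)`
(`a, b ∈ (0, H]`). [folklore] -/
theorem gridData_image_Ioo {a b : ℝ} (ha : a ∈ Ioc 0 H) (hb : b ∈ Ioc 0 H) :
    X '' Ioo a b = Ioo (X b) (X a) := by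
  refine Subset.antisymm ?_ ?_
  · rintro _ ⟨u, hu, rfl⟩
    have huD : u ∈ Ioc 0 H := ⟨ha.1.trans hu.1, hu.2.le.trans hb.2⟩
    exact ⟨hanti huD hb hu.2, hanti ha huD hu.1⟩
  · rintro s ⟨hsb, hsa⟩
    obtain ⟨w, hwD, rfl⟩ := hsurj s ((hXe b hb).trans hsb.le)
    exact ⟨w, ⟨(hanti.lt_iff_gt hwD ha).1 hsa, (hanti.lt_iff_gt hb hwD).1 hsb⟩, rfl⟩

/-- A strictly decreasing bijection `X : (0, H] → [e, ∞)` maps `[a, b]` onto `[X b, X a]`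
(`a, b ∈ (0, H]`). [folklore] -/
theorem gridData_image_Icc {a b : ℝ} (ha : a ∈ Ioc 0 H) (hb : b ∈ Ioc 0 H) :
    X '' Icc a b = Icc (X b) (X a) := by
  refine Subset.antisymm ?_ ?_
  · rintro _ ⟨u, hu, rfl⟩
    have huD : u ∈ Ioc 0 H := ⟨ha.1.trans_le hu.1, hu.2.trans hb.2⟩
    exact ⟨(hanti.le_iff_ge hb huD).2 hu.2, (hanti.le_iff_ge huD ha).2 hu.1⟩
  · rintro s ⟨hsb, hsa⟩
    obtain ⟨w, hwD, rfl⟩ := hsurj s ((hXe b hb).trans hsb)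
    exact ⟨w, ⟨(hanti.le_iff_ge hwD ha).1 hsa, (hanti.le_iff_ge hb hwD).1 hsb⟩, rfl⟩

/-- A strictly decreasing bijection `X : (0, H] → [e, ∞)` maps `(a, b]` onto `[X b, X a)`
(`a, b ∈ (0, H]`). [folklore] -/
theorem gridData_image_Ioc {a b : ℝ} (ha : a ∈ Ioc 0 H) (hb : b ∈ Ioc 0 H) :
    X '' Ioc a b = Ico (X b) (X a) := by
  refine Subset.antisymm ?_ ?_
  · rintro _ ⟨u, hu, rfl⟩
    have huD : u ∈ Ioc 0 H := ⟨ha.1.trans hu.1, hu.2.trans hb.2⟩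
    exact ⟨(hanti.le_iff_ge hb huD).2 hu.2, hanti ha huD hu.1⟩
  · rintro s ⟨hsb, hsa⟩
    obtain ⟨w, hwD, rfl⟩ := hsurj s ((hXe b hb).trans hsb)
    exact ⟨w, ⟨(hanti.lt_iff_gt hwD ha).1 hsa, (hanti.le_iff_ge hb hwD).1 hsb⟩, rfl⟩

/-- A strictly decreasing bijection `X : (0, H] → [e, ∞)` maps `(0, b)` onto `(X b, ∞)`
(`b ∈ (0, H]`). [folklore] -/
theorem gridData_image_Ioo_zero {b : ℝ} (hb : b ∈ Ioc 0 H) :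
    X '' Ioo 0 b = Ioi (X b) := by
  refine Subset.antisymm ?_ ?_
  · rintro _ ⟨u, hu, rfl⟩
    exact hanti ⟨hu.1, hu.2.le.trans hb.2⟩ hb hu.2
  · rintro s hsb
    obtain ⟨w, hwD, rfl⟩ := hsurj s ((hXe b hb).trans (le_of_lt hsb))
    exact ⟨w, ⟨hwD.1, (hanti.lt_iff_gt hb hwD).1 hsb⟩, rfl⟩

/-- A strictly decreasing bijection `X : (0, H] → [e, ∞)` maps `(0, b]` onto `[X b, ∞)`
(`b ∈ (0, H]`). [folklore] -/
theorem gridData_image_Ioc_zero {b : ℝ} (hb : b ∈ Ioc 0 H) :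
    X '' Ioc 0 b = Ici (X b) := by
  refine Subset.antisymm ?_ ?_
  · rintro _ ⟨u, hu, rfl⟩
    exact (hanti.le_iff_ge hb ⟨hu.1, hu.2.trans hb.2⟩).2 hu.2
  · rintro s hsb
    obtain ⟨w, hwD, rfl⟩ := hsurj s ((hXe b hb).trans hsb)
    exact ⟨w, ⟨hwD.1, (hanti.le_iff_ge hb hwD).1 hsb⟩, rfl⟩

end Param

end Summit.KontsevichZagierPeriods.KontsevichZagierPeriods.Cruxes.NeronTorsionSector.Translation
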